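import Literature.MathematicalPhysics.QuantumFieldTheory.Balaban1983to89.B10Eq55GaussianStepPresentation
import Literature.MathematicalPhysics.QuantumFieldTheory.Balaban1983to89.B1Eq324BenfattoClassSandwichedCutoff
import HarnessLib

/-!
# `Balaban1983to89.B10Eq55GaussianStepBallCutoff` — [Balaban1982Higgs1] (3.24) for cell lit-balaban's `dμ_{C^{(k)}}` of [Balaban1985UV3] (55)∕(58)
# (`B10Eq55GaussianStep.gaussMeasure`) WITH PRINT'S CUT-OFF SHAPE `χ = Π_b χ({|A(b)| ≤ p})` — a product of `𝔤`-norm balls read in the coordinates of a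
# basis — on a labelled torus block at every coupling `η ∈ (0,1]` (seat dag-n08-b gen 15, CLAIM-4 = CLAIM-2 ∘ CLAIM-3)

statement-level companion of a published source with citation tags; every declaration here is a theorem; nothing here is
a claim about the Yang–Mills mass gap

THE PRINTED LOCUS.  [Balaban1985UV3] p. 268, (51): *"χ = Π_{b∈B(Λ_{k+1})} χ({|A(b)| < g_kp²(g_k)})"*; p. 270, (58): *"∫dμ_{C^{(k)}}(A)χ exp[𝒱(A) +
O((L^kε)^{3+κ₀})|T₁^{(k)}|]; cumulant expansion to 6th order"*; p. 271: *"we write the integral in terms of the independent variables Ã … A = CÃ, and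
we obtain the Gaussian integral determined by the positive quadratic form ⟨A, C*Δ_kCA⟩"*; [Balaban1985BackgroundPropagators] p. 390: *"a norm |X| of a
N × N matrix means the Hilbert–Schmidt norm"*.

WHY THIS MODULE (cell `pub-ymgap`, seat `dag-n08-b` gen 15, CLAIM-4; node N08 [Balaban1985UV3]).  `…B10Eq55GaussianStepPresentation.eq324_gaussMeasure_torus_on_unit`
(p647337) gives (3.24) for lit-balaban's measure with the class road's COORDINATE-BOX cut-off; `…B1Eq324BenfattoClassSandwichedCutoff.eq324_torus_ballCutoff_on_unit`
(CLAIM-3; located point «N08 CHECK D») moves the road to print's BALL-PRODUCT cut-off by a monotone sandwich.  This file composes the two BY NAME: the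
(3.24) pair for `dμ_{C^{(k)}}` with the event `{A : ∀ bonds c₀, √(Σ_{π b = c₀} (b.equivFun A)_b²) ≤ p_{b₀}(η)}` pulled back along the presentation
`Φ = b.equivFun.symm ∘ (z ↦ z ∘ e)`, which is how the (α)-socket reads a cut-off (`Φ⁻¹' box`).

WHAT IS PROVED (standard axioms; no `sorry`; no definition).
* `preimage_ballBox_eq` — `Φ⁻¹'{A | ∀ c₀, √(Σ_{π b = c₀} (b.equivFun A)_b²) ≤ p} = (z ↦ z ∘ e)⁻¹'{ω | ∀ c₀, √(Σ_{π b = c₀} ω_b²) ≤ p}`.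
* ★★★ `eq324_gaussMeasure_torus_ballCutoff_on_unit` — class scalars `(d, m, n, γ, K, κ_T, t, D, ϰ, p₀, σ, c, κ)` FIRST; for EVERY `η ∈ (0,1]`, `N`, torus-labelled
  variables `β`, space of independent variables `S` with Lebesgue `μ` (any normalisation), basis `b`, form `Δ` whose matrix is symmetric, `γ`-coercive and
  decaying: `∃ Λ e` with the PRESENTATION `gaussMeasure μ Δ = (μ_K).map Φ` and, for every bond map `π` with fibres `≤ n` and every `(s, J ⊆ Λ, a)`, the
  (3.24) pair for the ball-product cut-off at threshold `p_{b₀}(η)`, error `C·η^κ·|Λ|`.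
HONEST SCOPE.  Count-neutral composition of two landed files of this seat; lit-balaban's `S, μ, Δ` ABSTRACT (dictionary theirs); the member rows DISPLAYED (node
N06's content); the bond map `π` and the basis are WHATEVER the IDENT supplies (for print: `β` = bonds of `Λ̃` × an orthonormal basis of `𝔤`, `π` = the bond,
`n = d(𝔤)`); NOT the IDENT, NOT commissioned, NOT claimed; nothing of [Balaban1985UV3], [Balaban1984UV2], [BenfattoEtAl1978] or [Balaban1985BackgroundPropagators]
is asserted or discharged; `PrintedUV3V` NOT proved; node N08 NOT discharged; nothing about d = 4, the continuum, OS axioms, a mass gap or the Clay problem.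
-/

noncomputable section

open MeasureTheory Finset Matrix

namespace Literature.MathematicalPhysics.QuantumFieldTheory.Balaban1983to89.B10Eq55GaussianStepBallCutoff

open Literature.MathematicalPhysics.QuantumFieldTheory
open Literature.MathematicalPhysics.QuantumFieldTheory.Balaban1983to89.B1Eq324BenfattoLemma
open Literature.MathematicalPhysics.QuantumFieldTheory.Balaban1983to89.B1Eq324BenfattoClassPresentation (measurable_restrictAlong)
open Literature.MathematicalPhysics.QuantumFieldTheory.Balaban1983to89.B1Eq324BenfattoClassSandwichedCutoff (eq324_torus_ballCutoff_on_unit)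
open Literature.MathematicalPhysics.QuantumFieldTheory.Balaban1983to89.B10Eq55GaussianStep (gaussMeasure)
open Literature.MathematicalPhysics.QuantumFieldTheory.Balaban1983to89.B10Eq55GaussianStepPresentation
  (gaussMeasure_eq_map_gaussianFieldOfKernel posDef_toMatrix₂_of_coercive)

variable {d : ℕ}

/-- **THE BALL BOX PULLS BACK ALONG THE PRESENTATION**: for `Φ = b.equivFun.symm ∘ (z ↦ z ∘ e)`,
`Φ⁻¹'{A : S | ∀ c₀, √(Σ_{π b = c₀} (b.equivFun A)_b²) ≤ p} = (z ↦ z ∘ e)⁻¹'{ω | ∀ c₀, √(Σ_{π b = c₀} ω_b²) ≤ p}` (`b.equivFun ∘ b.equivFun.symm = id`).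
[cite: Balaban1985UV3, (51) p.268 (the cut-off `χ`; coordinate bookkeeping ours)] -/
theorem preimage_ballBox_eq {β B S X : Type*} [Fintype β] [DecidableEq B] [AddCommGroup S] [Module ℝ S]
    (bs : Module.Basis β ℝ S) (π : β → B) (r : X → β → ℝ) (p : ℝ) :
    (fun x => bs.equivFun.symm (r x)) ⁻¹'
        {A : S | ∀ c₀ : B, Real.sqrt (∑ b ∈ Finset.univ.filter (fun b => π b = c₀), bs.equivFun A b ^ 2) ≤ p} =
      r ⁻¹' {ω : β → ℝ | ∀ c₀ : B, Real.sqrt (∑ b ∈ Finset.univ.filter (fun b => π b = c₀), ω b ^ 2) ≤ p} := by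
  ext x
  simp only [Set.mem_preimage, Set.mem_setOf_eq, LinearEquiv.apply_symm_apply]

/-- ★★★ **(3.24) FOR `dμ_{C^{(k)}}` (AS TYPED BY CELL LIT-BALABAN) WITH PRINT'S BALL-PRODUCT CUT-OFF, ON A TORUS BLOCK, AT EVERY COUPLING `η ∈ (0,1]`.**
Class scalars FIRST: `d ≥ 1`, label count `m`, components per bond `n ≥ 1`, member scalars `γ > 0`, `K ≥ 0`, `κ_T > 0`, and the (3.24) letters `t D`, `ϰ > 0`,
`p₀ > 2/3`, `σ > 0`, `c ≥ 0`, `0 < κ < σ(t+1)`.  THEN `∃ b₁ ∀ b₀ > b₁ ∃ C ≥ 0` such that for EVERY `η ∈ (0,1]`, torus size `N`, variables `β ≠ ∅` labelled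
injectively by `(site, lab)`, space of independent variables `S` with a Lebesgue measure `μ` (any normalisation), basis `bs : Basis β ℝ S`, form `Δ` whose matrix
`M = toMatrix₂ bs bs Δ` is symmetric, `γ`-coercive and decays like `K e^{−κ_Tρ}` (`ρ ≥` torus sup-distance of the sites): a window `Λ ⊂ ℤ^{2d+1}`, `e : β ≃ ↥Λ`
with the presentation `gaussMeasure μ Δ = (μ_K).map (bs.equivFun.symm ∘ (z ↦ z ∘ e))`, and for every bond map `π : β → B` with fibres of at most `n`
coordinates and all `(s, J ⊆ Λ, a)` with `sup|a| ≤ c·η^σ`: `0 < ∫ 1_{Φ⁻¹' χ-box} e^{H_J} dμ_K` and `|log ∫ 1_{Φ⁻¹' χ-box} e^{H_J} dμ_K − Σ_{k≤t}𝓔^T(H_J;k)/k!| ≤ C·η^κ·|Λ|`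
with `χ-box = {A | ∀ c₀, √(Σ_{π b = c₀} (bs.equivFun A)_b²) ≤ p_{b₀}(η)}` — print's `Π_b χ(|A(b)| ≤ p)` when `π` is the bond of a coordinate and the basis is
orthonormal on each `𝔤`-fibre.  Proof: `…ClassSandwichedCutoff.eq324_torus_ballCutoff_on_unit` + `…GaussianStepPresentation.gaussMeasure_eq_map_gaussianFieldOfKernel`
+ `preimage_ballBox_eq`.
[cite: Balaban1985UV3, (51) p.268, (55) p.269, (58) p.270, p.271; Balaban1985BackgroundPropagators, p.390, (3.155)–(3.158) pp.427–428;
Balaban1982Higgs1, (3.24) p.616; BenfattoEtAl1978, Lemma (4.5)–(4.7) p.152 (class form; bent window and sandwich ours)] -/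
theorem eq324_gaussMeasure_torus_ballCutoff_on_unit (hd : 0 < d) (m n : ℕ) (hn : 1 ≤ n) {γ K κT : ℝ} (hγ0 : 0 < γ) (hK : 0 ≤ K)
    (hκT : 0 < κT) (t D : ℕ) {ϰ : ℝ} (hϰ : 0 < ϰ) {p₀ σ c κ : ℝ} (hp₀ : 2 / 3 < p₀) (hσ : 0 < σ) (hc : 0 ≤ c) (hκ : 0 < κ)
    (hκσ : κ < σ * (t + 1)) :
    ∃ b₁ : ℝ, ∀ b₀ : ℝ, b₁ < b₀ → ∃ C : ℝ, 0 ≤ C ∧ ∀ η : ℝ, 0 < η → η ≤ 1 →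
      ∀ {N : ℕ} [NeZero N] {β : Type} [Fintype β] [DecidableEq β] [Nonempty β]
        (site : β → Fin d → ZMod N) (lab : β → Fin m), (Function.Injective fun b => (site b, lab b)) →
      ∀ {S : Type} [NormedAddCommGroup S] [NormedSpace ℝ S] [MeasurableSpace S] [BorelSpace S]
        (μ : Measure S) [μ.IsAddHaarMeasure] (bs : Module.Basis β ℝ S) (Δ : S →ₗ[ℝ] S →ₗ[ℝ] ℝ) {ρ : β → β → ℝ},
        (∀ b b', LinearMap.toMatrix₂ bs bs Δ b b' = LinearMap.toMatrix₂ bs bs Δ b' b) →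
        (∀ v : β → ℝ, γ * ∑ b, v b ^ 2 ≤ ∑ b, ∑ b', LinearMap.toMatrix₂ bs bs Δ b b' * v b * v b') →
        (∀ b b', |LinearMap.toMatrix₂ bs bs Δ b b'| ≤ K * Real.exp (-(κT * ρ b b'))) →
        (∀ b b' i, (|((site b i - site b' i).valMinAbs : ℤ)| : ℝ) ≤ ρ b b') →
      ∃ (Λ : Finset (B1Eq324BenfattoLemma.Site (d + d + 1))) (e : β ≃ ↥Λ),
        gaussMeasure μ Δ =
          (gaussianFieldOfKernel fun x y => if h : x ∈ Λ ∧ y ∈ Λ then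
              ((Matrix.reindex e e (LinearMap.toMatrix₂ bs bs Δ))⁻¹ : Matrix ↥Λ ↥Λ ℝ) ⟨x, h.1⟩ ⟨y, h.2⟩ else 0).map
            (fun (z : B1Eq324BenfattoLemma.Site (d + d + 1) → ℝ) => bs.equivFun.symm fun b : β => z ((e b : ↥Λ) : B1Eq324BenfattoLemma.Site (d + d + 1))) ∧
        ∀ {B : Type} [Fintype B] [DecidableEq B] (π : β → B),
          (∀ c₀ : B, (Finset.univ.filter (fun b => π b = c₀)).card ≤ n) →
        ∀ (s : ℕ) (J : Finset (B1Eq324BenfattoLemma.Site (d + d + 1))) (a : Coef (d + d + 1)), J ⊆ Λ →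
          coefSup s D a J ≤ c * η ^ σ →
          0 < ∫ z, ((fun (z : B1Eq324BenfattoLemma.Site (d + d + 1) → ℝ) => bs.equivFun.symm fun b : β => z ((e b : ↥Λ) : B1Eq324BenfattoLemma.Site (d + d + 1))) ⁻¹'
                {A : S | ∀ c₀ : B, Real.sqrt (∑ b ∈ Finset.univ.filter (fun b => π b = c₀), bs.equivFun A b ^ 2) ≤ B10.pFun b₀ p₀ η}).indicator
                (fun z => Real.exp (hamiltonian s D ϰ a J z)) z ∂(gaussianFieldOfKernel fun x y =>
              if h : x ∈ Λ ∧ y ∈ Λ then ((Matrix.reindex e e (LinearMap.toMatrix₂ bs bs Δ))⁻¹ : Matrix ↥Λ ↥Λ ℝ) ⟨x, h.1⟩ ⟨y, h.2⟩ else 0) ∧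
            |Real.log (∫ z, ((fun (z : B1Eq324BenfattoLemma.Site (d + d + 1) → ℝ) => bs.equivFun.symm fun b : β =>
                  z ((e b : ↥Λ) : B1Eq324BenfattoLemma.Site (d + d + 1))) ⁻¹'
                {A : S | ∀ c₀ : B, Real.sqrt (∑ b ∈ Finset.univ.filter (fun b => π b = c₀), bs.equivFun A b ^ 2) ≤ B10.pFun b₀ p₀ η}).indicator
                (fun z => Real.exp (hamiltonian s D ϰ a J z)) z ∂(gaussianFieldOfKernel fun x y =>
                if h : x ∈ Λ ∧ y ∈ Λ then ((Matrix.reindex e e (LinearMap.toMatrix₂ bs bs Δ))⁻¹ : Matrix ↥Λ ↥Λ ℝ) ⟨x, h.1⟩ ⟨y, h.2⟩ else 0)) -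
              cumulantSum (gaussianFieldOfKernel fun x y =>
                if h : x ∈ Λ ∧ y ∈ Λ then ((Matrix.reindex e e (LinearMap.toMatrix₂ bs bs Δ))⁻¹ : Matrix ↥Λ ↥Λ ℝ) ⟨x, h.1⟩ ⟨y, h.2⟩ else 0)
                (hamiltonian s D ϰ a J) t| ≤ C * η ^ κ * Λ.card := by
  obtain ⟨b₁, hb₁⟩ := eq324_torus_ballCutoff_on_unit (d := d) hd m n hn hγ0 hK hκT t D hϰ hp₀ hσ hc hκ hκσ
  refine ⟨b₁, fun b₀ hb₀ => ?_⟩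
  obtain ⟨C, hC, hE⟩ := hb₁ b₀ hb₀
  refine ⟨C, hC, fun η hη hηle N _ β _ _ _ site lab hinj S _ _ _ _ μ _ bs Δ ρ hTs hγ hdec hρ => ?_⟩
  obtain ⟨Λ, e, hmap, hEv⟩ := hE η hη hηle site lab hinj hTs hγ hdec hρ
  have hM : (LinearMap.toMatrix₂ bs bs Δ).PosDef := posDef_toMatrix₂_of_coercive bs Δ hTs hγ0 hγ
  have hsym : Measurable (⇑bs.equivFun.symm : (β → ℝ) → S) := bs.equivFunL.symm.continuous.measurable
  have hrA : Measurable fun (z : B1Eq324BenfattoLemma.Site (d + d + 1) → ℝ) (b : β) => z ((e b : ↥Λ) : B1Eq324BenfattoLemma.Site (d + d + 1)) :=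
    measurable_restrictAlong e
  refine ⟨Λ, e, ?_, @fun B _ _ π hπ s J a hJΛ hA => ?_⟩
  · rw [gaussMeasure_eq_map_gaussianFieldOfKernel μ bs Δ hM, ← hmap, Measure.map_map hsym hrA]
    rfl
  · rw [preimage_ballBox_eq bs π (fun (z : B1Eq324BenfattoLemma.Site (d + d + 1) → ℝ) (b : β) => z ((e b : ↥Λ) : B1Eq324BenfattoLemma.Site (d + d + 1)))]
    exact hEv π hπ s J a hJΛ hA

/-- Non-vacuity of the scalar side (the binder list elaborates end to end): `d = 3`, `m = 24`, `n = 8 = d(su(3))`, `γ = 1`, `K = 2`, `κ_T = 1/3`, socket letters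
`t = 6`, `D = 4`, `ϰ = 1`, `p₀ = 1`, `σ = 1/2`, `c = 1`, `κ = 13/4`. [cite: Balaban1985UV3, (58) p.270 (letters of the socket; instance ours)] -/
example :=
  eq324_gaussMeasure_torus_ballCutoff_on_unit (d := 3) (by norm_num) 24 8 (by norm_num) (γ := 1) (K := 2) (κT := 1 / 3) one_pos (by norm_num)
    (by norm_num) 6 4 (ϰ := 1) one_pos (p₀ := 1) (σ := 1 / 2) (c := 1) (κ := 13 / 4) (by norm_num) (by norm_num) zero_le_one
    (by norm_num) (by norm_num)

end Literature.MathematicalPhysics.QuantumFieldTheory.Balaban1983to89.B10Eq55GaussianStepBallCutoff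

end
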